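import Summits.QuantumFields.BalabanUV.Gaps.EndRunwiseShooting

/-!
# Gaps / EndTopRunCriterion — THE END BINDER IS EXACTLY «NO BACKSLIDING FROM THE TOP» FOR ORDER-PRESERVING FLOWS: an IFF for
# `DagBinding.EndpointExistence` in run-wise currency, constant included, when in-interval runs of (0.20) do not cross (e.g. (0.20) read Markov
# as printed, `β_{k+1}(g_k)` Lipschitz in `g_k` on a small box)
# (cell pub-balaban-gaps, seat g1-p3 gen 6, row CAP+tail ∕ β-currency «split ∕ weakening»; sequel of `Gaps/EndRunwiseShooting`)

HONEST FRAMING (cell rule, page 1 of everything): [folklore] real analysis over the tree's typed carriers (`FlowStep.RGEqH`, `FlowStep.Y`,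
`FlowStep.ofMarkov`, `DagBinding.ForwardGenerated` ∕ `EndpointExistence`, `FlowStepRuns.HaltsOutside` ∕ `CurriesHBeta`).  [I] Thm 2 is
UNPROVED in print; `EndpointExistence` (its first sentence) appears only inside an EQUIVALENCE between two statements about a β-family — a
typing fact about the END binder, not a discharge of it.  The order-preservation hypothesis is a binder (met by Markov families with a
Lipschitz bound, §1); whether Bałaban's history-dependent β-functions (p. 298) preserve order is NOT asserted.  NOTHING of Bałaban's is
asserted; 0∕6 binders; 0 coefficients certified; one finite T⁴; NOT B12 Thm 2, NOT `BetaPertH`, NOT the continuum limit, NOT Clay.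

THE POINT.  `FlowStepRuns` §7 asked for «what the endpoint-existence half needs EXACTLY» and answered with window-sum currencies that are
sufficient but not necessary (g1-plan-2 S-33; `EndRunwiseShooting` pushed the sufficient class down to in-interval RUNS that sit at the top of
the interval).  For flows whose in-interval runs DO NOT CROSS (strict order preservation: `g_0 < g′_0 ⟹ g_k < g′_k`), the top-run form IS
exact, constant included:
* §1 — ORDER PRESERVATION from the printed Markov reading: `β = ofMarkov βM` with `x ↦ 1∕x² − β_{k+1}(x)` strictly decreasing on `]0,γ]`
  (`strictOrder_ofMarkov`), in particular whenever `β_{k+1}` is Lipschitz on `]0,γ]` with constant `≤ 2∕γ³` (`anti_of_lipschitz`) — so ANY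
  fixed Lipschitz constant qualifies on a small enough box; and in-interval runs from the same bare coupling coincide (`run_eq_of_start_eq`,
  no hypothesis).
* §2 — NECESSITY (no continuity needed): if `g⋆` is reached at every length `K` by in-interval runs and runs do not cross, then NO in-interval
  run that sits at `γ` at some step ends below `g⋆` (`le_end_of_topRun`): a run reaching `g⋆` from a smaller start would have to pass under it,
  from a larger start would have to exceed `γ`, from the same start IS it.
* §3 — **THE CRITERION** (`reachable_iff_topRuns`): `β` continuous and `≤ β′` on the boxes `]0,γ]^{k+1}`, runs non-crossing at level `γ`,
  `0 < g⋆ ≤ γ`: «every `g ∈ ]0,g⋆]` is the endpoint `g_K` of an in-interval run, for every `K`» ⟺ «every in-interval run that sits at `γ` at a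
  step `k ≤ n` has `g_n ≥ g⋆`» (⟸ is `EndRunwiseShooting.couplingTrajectory_exists_of_topRuns` with `M = 1∕g⋆² − 1∕γ²`; ⟹ is §2).  Hence the
  reachable targets are DOWNWARD CLOSED (`reachable_downward_closed`), and at construction level (`ForwardGenerated`, `HaltsOutside`,
  `CurriesHBeta` — the three modelling clauses of `FlowStepRuns`, all met by `modelOf`): **`endpointExistence_iff_topRuns`** —
  `EndpointExistence C ↔ ∃ γ₂ > 0, ∀ γ ≤ γ₂, ∃ g⋆ > 0, no in-interval run in ]0,γ] sitting at γ ends below g⋆`.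
RELEVANCE: for the print-faithful T⁴ headline's β-binder `hEnd : EndpointExistence D.C.toB12` this is, on order-preserving data, an EXACT
β-side restatement in the currency of the realised flow (what the top runs do), replacing the one-directional roads W-β ⟹ `hEnd` (SK-W) and
run-wise (PS) ⟹ `hEnd` (`EndRunwiseShooting`); off order-preserving data the top-run form stays sufficient (`EndRunwiseShooting`) and the exact
criterion is the shooting statement itself.  0 sorry; 0 def; imports `Gaps/EndRunwiseShooting` only; restates nothing.

CITATION HEADER (tags CONTEXT ONLY).  [I] = T. Bałaban, Commun. Math. Phys. **109** (1987) [Balaban1987RG1]: Thm 2 p. 259 (first sentence),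
(0.20) p. 256 («β_{k+1}(g_k)»), §1 pp. 263–264 («C^∞-function of g_{j−1} ∈ [0,γ]»), §5 p. 298 (history dependence).
-/

namespace Summit.QuantumFields.BalabanUV.Gaps.EndTopRunCriterion

open Literature.MathematicalPhysics.QuantumFieldTheory.Balaban1983to89
open Literature.MathematicalPhysics.QuantumFieldTheory.Balaban1983to89.FlowStep
open Literature.MathematicalPhysics.QuantumFieldTheory.Balaban1983to89.FlowStepRuns
open Literature.MathematicalPhysics.QuantumFieldTheory.Balaban1983to89.DagBinding
open Summit.QuantumFields.BalabanUV.Gaps.EndRunwiseShooting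
open Finset

noncomputable section

variable {β : HBeta} {γ : ℝ}

/-! ## §1 Non-crossing of in-interval runs: uniqueness from the start, and the Markov ∕ Lipschitz sufficient condition -/

/-- In-interval solutions of (0.20) from the SAME bare coupling coincide (both are the unclamped shooting trajectory from it,
`EndRunwiseShooting.Y_eq_of_run`). [cite: Balaban1987RG1, (0.20) p.256] -/
theorem run_eq_of_start_eq {n : ℕ} {gs gs' : ℕ → ℝ} (hrg : RGEqH n β gs) (hrg' : RGEqH n β gs')
    (hI : Step.InInterval γ n gs) (hI' : Step.InInterval γ n gs') (h0 : gs 0 = gs' 0) :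
    ∀ k, k ≤ n → gs k = gs' k := by
  intro k hk
  have h1 := congrFun (Y_eq_of_run hrg hI k hk).2 (Fin.last k)
  have h2 := congrFun (Y_eq_of_run hrg' hI' k hk).2 (Fin.last k)
  simp only [clampPrefix, prefixOf_apply, Fin.val_last] at h1 h2
  rw [← h1, ← h2, h0]

/-- ORDER PRESERVATION FOR MARKOV FAMILIES.  If (0.20) is read Markov as printed (`β = FlowStep.ofMarkov βM`, `β_{k+1}` a function of `g_k`
alone) and each `x ↦ 1∕x² − β_{k+1}(x)` is STRICTLY DECREASING on `]0,γ]`, then in-interval runs do not cross: `g_0 < g′_0 ⟹ g_k < g′_k` for all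
`k ≤ n`. [cite: Balaban1987RG1, (0.20) p.256] -/
theorem strictOrder_ofMarkov {βM : ℕ → ℝ → ℝ}
    (hanti : ∀ (k : ℕ) (x y : ℝ), 0 < x → x < y → y ≤ γ → 1 / y ^ 2 - βM (k + 1) y < 1 / x ^ 2 - βM (k + 1) x)
    {n : ℕ} {gs gs' : ℕ → ℝ} (hrg : RGEqH n (ofMarkov βM) gs) (hrg' : RGEqH n (ofMarkov βM) gs')
    (hI : Step.InInterval γ n gs) (hI' : Step.InInterval γ n gs') (h0 : gs 0 < gs' 0) :
    ∀ k, k ≤ n → gs k < gs' k := by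
  intro k
  induction k with
  | zero => exact fun _ => h0
  | succ k ih =>
    intro hk
    have hlt := ih (Nat.le_of_succ_le hk)
    have e1 : 1 / (gs k) ^ 2 = 1 / (gs (k + 1)) ^ 2 + βM (k + 1) (gs k) := by
      have := hrg k (Nat.lt_of_succ_le hk); simpa [ofMarkov, prefixOf] using this
    have e2 : 1 / (gs' k) ^ 2 = 1 / (gs' (k + 1)) ^ 2 + βM (k + 1) (gs' k) := by
      have := hrg' k (Nat.lt_of_succ_le hk); simpa [ofMarkov, prefixOf] using this
    have h := hanti k (gs k) (gs' k) (hI k (Nat.le_of_succ_le hk)).1 hlt (hI' k (Nat.le_of_succ_le hk)).2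
    have hinv : 1 / (gs' (k + 1)) ^ 2 < 1 / (gs (k + 1)) ^ 2 := by linarith
    have hp : 0 < gs (k + 1) := (hI (k + 1) hk).1
    have hp' : 0 < gs' (k + 1) := (hI' (k + 1) hk).1
    by_contra hle
    push Not at hle
    have : 1 / (gs (k + 1)) ^ 2 ≤ 1 / (gs' (k + 1)) ^ 2 :=
      one_div_le_one_div_of_le (by positivity) (pow_le_pow_left₀ hp'.le hle 2)
    linarith

/-- THE LIPSCHITZ SUFFICIENT CONDITION: if `β_{k+1}` is Lipschitz on `]0,γ]` with constant `≤ 2∕γ³` (the infimum of `|d(1∕x²)∕dx| = 2∕x³`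
on `]0,γ]`), then `x ↦ 1∕x² − β_{k+1}(x)` is strictly decreasing there (`1∕x² − 1∕y² > 2(y − x)∕γ³` for `0 < x < y ≤ γ`).  So a family with ANY
fixed Lipschitz constant `Λ` in the coupling (p. 263: «C^∞-function of g_{j−1} ∈ [0,γ]») is order-preserving on every box with `γ³ ≤ 2∕Λ`
(threshold `2∕γ³` per g1-plan-2 X-91 P-1). [cite: Balaban1987RG1, §1 p.263] -/
theorem anti_of_lipschitz {βM : ℕ → ℝ → ℝ} (hγ : 0 < γ)
    (hlip : ∀ (k : ℕ) (x y : ℝ), 0 < x → x ≤ γ → 0 < y → y ≤ γ → |βM (k + 1) x - βM (k + 1) y| ≤ 2 / γ ^ 3 * |x - y|) :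
    ∀ (k : ℕ) (x y : ℝ), 0 < x → x < y → y ≤ γ → 1 / y ^ 2 - βM (k + 1) y < 1 / x ^ 2 - βM (k + 1) x := by
  intro k x y hx hxy hyγ
  have hy : 0 < y := hx.trans hxy
  have hxγ : x ≤ γ := hxy.le.trans hyγ
  have hl := hlip k x y hx hxγ hy hyγ
  rw [abs_sub_comm x y, abs_of_pos (sub_pos.mpr hxy)] at hl
  have hβ : βM (k + 1) x - βM (k + 1) y ≤ 2 / γ ^ 3 * (y - x) := (le_abs_self _).trans hl
  -- `1∕x² − 1∕y² > 2(y − x)∕γ³`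
  have hgap : 2 / γ ^ 3 * (y - x) < 1 / x ^ 2 - 1 / y ^ 2 := by
    have hx2 : 0 < x ^ 2 := by positivity
    have hy2 : 0 < y ^ 2 := by positivity
    have hγ3 : 0 < γ ^ 3 := by positivity
    -- `2x²y² < (x + y)γ³` from `x·y² ≤ γ³` and `x²·y < γ³` (`x < γ`)
    have h1 : x * y ^ 2 ≤ γ ^ 3 := by
      calc x * y ^ 2 ≤ γ * γ ^ 2 := mul_le_mul hxγ (pow_le_pow_left₀ hy.le hyγ 2) hy2.le hγ.le
        _ = γ ^ 3 := by ring
    have hxγ' : x < γ := lt_of_lt_of_le hxy hyγ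
    have h2 : x ^ 2 * y < γ ^ 3 := by
      calc x ^ 2 * y < γ ^ 2 * y := by
            exact mul_lt_mul_of_pos_right (by nlinarith) hy
        _ ≤ γ ^ 2 * γ := by exact mul_le_mul_of_nonneg_left hyγ (by positivity)
        _ = γ ^ 3 := by ring
    have key : 2 * (x ^ 2 * y ^ 2) < (x + y) * γ ^ 3 := by nlinarith [mul_le_mul_of_nonneg_left h1 hx.le, mul_lt_mul_of_pos_left h2 hy]
    rw [div_mul_eq_mul_div, div_sub_div _ _ hx2.ne' hy2.ne', div_lt_div_iff₀ hγ3 (mul_pos hx2 hy2)]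
    nlinarith [mul_lt_mul_of_pos_left key (sub_pos.mpr hxy)]
  linarith

/-! ## §2 Necessity: under non-crossing, reachability of `g⋆` at every length forbids top runs ending below `g⋆` -/

/-- **NECESSITY OF THE TOP-RUN BOUND (no continuity).**  At level `γ`, suppose in-interval runs of (0.20) do not cross and the target `g⋆` is the
endpoint of some in-interval run of EVERY length `K`.  Then every in-interval run that SITS AT `γ` at a step `k ≤ n` has `g_n ≥ g⋆`: the run
reaching `g⋆` at time `n` starts below, at, or above the sitting run's start — below, it stays below and ends below `g_n`; at, it IS the sitting
run; above, it would exceed `γ` at step `k`. [cite: Balaban1987RG1, Thm 2 p.259 and (0.20) p.256] -/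
theorem le_end_of_topRun
    (hord : ∀ (n : ℕ) (gs gs' : ℕ → ℝ), RGEqH n β gs → RGEqH n β gs' → Step.InInterval γ n gs → Step.InInterval γ n gs' →
      gs 0 < gs' 0 → ∀ k, k ≤ n → gs k < gs' k)
    {gstar : ℝ} (hreach : ∀ K : ℕ, ∃ gs : ℕ → ℝ, gs K = gstar ∧ RGEqH K β gs ∧ Step.InInterval γ K gs)
    {n : ℕ} {gs : ℕ → ℝ} (hrg : RGEqH n β gs) (hI : Step.InInterval γ n gs) {k : ℕ} (hk : k ≤ n) (hgk : gs k = γ) :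
    gstar ≤ gs n := by
  obtain ⟨gs', hn', hrg', hI'⟩ := hreach n
  rcases lt_trichotomy (gs' 0) (gs 0) with hlt | heq | hgt
  · exact hn' ▸ (hord n gs' gs hrg' hrg hI' hI hlt n le_rfl).le
  · rw [← hn', run_eq_of_start_eq hrg' hrg hI' hI heq n le_rfl]
  · exact absurd (hI' k hk).2 (not_le.mpr (hgk ▸ hord n gs gs' hrg hrg' hI hI' hgt k hk))

/-- Hence, in window-sum currency: under non-crossing and reachability of `g⋆ ≤ γ` at every length, every in-interval run sitting at `γ` at
step `k` has `Σ_{j∈[k,n)} β_j ≥ 1∕γ² − 1∕g⋆²` — the TOP form of `EndRunwiseShooting` with `M = 1∕g⋆² − 1∕γ²` is NECESSARY. [cite: Balaban1987RG1, (0.20) p.256] -/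
theorem topRuns_of_reachable (hγ : 0 < γ)
    (hord : ∀ (n : ℕ) (gs gs' : ℕ → ℝ), RGEqH n β gs → RGEqH n β gs' → Step.InInterval γ n gs → Step.InInterval γ n gs' →
      gs 0 < gs' 0 → ∀ k, k ≤ n → gs k < gs' k)
    {gstar : ℝ} (hgstar : 0 < gstar) (hreach : ∀ K : ℕ, ∃ gs : ℕ → ℝ, gs K = gstar ∧ RGEqH K β gs ∧ Step.InInterval γ K gs) :
    ∀ (n : ℕ) (gs : ℕ → ℝ), RGEqH n β gs → Step.InInterval γ n gs →
      ∀ k, k ≤ n → gs k = γ → -(1 / gstar ^ 2 - 1 / γ ^ 2) ≤ ∑ j ∈ Finset.Ico k n, β j (prefixOf gs j) := by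
  intro n gs hrg hI k hk hgk
  have hend : gstar ≤ gs n := le_end_of_topRun hord hreach hrg hI hk hgk
  have ht := inv_sq_telescopeH hrg hk le_rfl
  have h1 : 1 / (gs n) ^ 2 ≤ 1 / gstar ^ 2 := one_div_le_one_div_of_le (by positivity) (pow_le_pow_left₀ hgstar.le hend 2)
  have h2 : 1 / (gs k) ^ 2 = 1 / γ ^ 2 := by rw [hgk]
  have _ := hγ
  linarith

/-! ## §3 The criterion -/

/-- **THE END CRITERION AT ONE LEVEL (iff, constant included).**  `β` jointly continuous and `≤ β′` on the boxes `]0,γ]^{k+1}`, in-interval runs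
non-crossing at level `γ`, `0 < g⋆ ≤ γ`.  Then: every target `g ∈ ]0,g⋆]` is the endpoint `g_K` of an in-interval solution of (0.20) for EVERY
`K` ⟺ every in-interval solution that sits at `γ` at some step `k ≤ n` ends at `g_n ≥ g⋆` («no backsliding from the top below `g⋆`»).
(⟸: `EndRunwiseShooting.couplingTrajectory_exists_of_topRuns` with `M = 1∕g⋆² − 1∕γ²`; ⟹: §2, reachability of `g⋆` alone.) [cite: Balaban1987RG1, Thm 2 p.259] -/
theorem reachable_iff_topRuns (hγ : 0 < γ) {β' : ℝ} (hβ' : 0 ≤ β') (hcont : BetaContH γ β) (hhi : BetaUpperH β' γ β)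
    (hord : ∀ (n : ℕ) (gs gs' : ℕ → ℝ), RGEqH n β gs → RGEqH n β gs' → Step.InInterval γ n gs → Step.InInterval γ n gs' →
      gs 0 < gs' 0 → ∀ k, k ≤ n → gs k < gs' k)
    {gstar : ℝ} (hgstar : 0 < gstar) (hgstarγ : gstar ≤ γ) :
    (∀ (K : ℕ) (g : ℝ), 0 < g → g ≤ gstar → ∃ gs : ℕ → ℝ, gs K = g ∧ RGEqH K β gs ∧ Step.InInterval γ K gs) ↔
    (∀ (n : ℕ) (gs : ℕ → ℝ), RGEqH n β gs → Step.InInterval γ n gs → ∀ k, k ≤ n → gs k = γ → gstar ≤ gs n) := by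
  constructor
  · intro hreach n gs hrg hI k hk hgk
    exact le_end_of_topRun hord (fun K => hreach K gstar hgstar le_rfl) hrg hI hk hgk
  · intro htop K g hg hgle
    have hM : 0 ≤ 1 / gstar ^ 2 - 1 / γ ^ 2 := by
      have := one_div_le_one_div_of_le (pow_pos hgstar 2) (pow_le_pow_left₀ hgstar.le hgstarγ 2); linarith
    have htop' : ∀ (n : ℕ) (gs : ℕ → ℝ), RGEqH n β gs → Step.InInterval γ n gs →
        ∀ k, k ≤ n → gs k = γ → -(1 / gstar ^ 2 - 1 / γ ^ 2) ≤ ∑ j ∈ Finset.Ico k n, β j (prefixOf gs j) := by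
      intro n gs hrg hI k hk hgk
      have hend := htop n gs hrg hI k hk hgk
      have ht := inv_sq_telescopeH hrg hk le_rfl
      have h1 : 1 / (gs n) ^ 2 ≤ 1 / gstar ^ 2 := one_div_le_one_div_of_le (by positivity) (pow_le_pow_left₀ hgstar.le hend 2)
      have h2 : 1 / (gs k) ^ 2 = 1 / γ ^ 2 := by rw [hgk]
      linarith
    have hg2 : 1 / γ ^ 2 + (1 / gstar ^ 2 - 1 / γ ^ 2) ≤ 1 / g ^ 2 := by
      have := one_div_le_one_div_of_le (pow_pos hg 2) (pow_le_pow_left₀ hg.le hgle 2); linarith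
    exact couplingTrajectory_exists_of_topRuns β hγ hM hβ' hcont hhi htop' K g hg hg2

/-- COROLLARY — REACHABLE TARGETS ARE DOWNWARD CLOSED under non-crossing: if `g⋆ ≤ γ` is the endpoint of an in-interval run of every length,
so is every `g ∈ ]0,g⋆]` (continuity + the upper bound + non-crossing).  Without non-crossing this can fail for history-dependent β. [folklore] -/
theorem reachable_downward_closed (hγ : 0 < γ) {β' : ℝ} (hβ' : 0 ≤ β') (hcont : BetaContH γ β) (hhi : BetaUpperH β' γ β)
    (hord : ∀ (n : ℕ) (gs gs' : ℕ → ℝ), RGEqH n β gs → RGEqH n β gs' → Step.InInterval γ n gs → Step.InInterval γ n gs' →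
      gs 0 < gs' 0 → ∀ k, k ≤ n → gs k < gs' k)
    {gstar : ℝ} (hgstar : 0 < gstar) (hgstarγ : gstar ≤ γ)
    (hreach : ∀ K : ℕ, ∃ gs : ℕ → ℝ, gs K = gstar ∧ RGEqH K β gs ∧ Step.InInterval γ K gs) :
    ∀ (K : ℕ) (g : ℝ), 0 < g → g ≤ gstar → ∃ gs : ℕ → ℝ, gs K = g ∧ RGEqH K β gs ∧ Step.InInterval γ K gs :=
  (reachable_iff_topRuns hγ hβ' hcont hhi hord hgstar hgstarγ).2
    fun _ _ hrg hI _ hk hgk => le_end_of_topRun hord hreach hrg hI hk hgk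

/-- **THE END CRITERION AT CONSTRUCTION LEVEL.**  For a construction generated forward by (0.20) with `β` that halts outside and curries `β`
(the three modelling clauses of `FlowStepRuns`, all met by `modelOf β`), with `β` jointly continuous and `≤ β′` on `]0,γ₀]^{k+1}` and
in-interval runs non-crossing at every level `γ ≤ γ₀`:
`EndpointExistence C ↔ ∃ γ₂ > 0, ∀ γ ∈ ]0,γ₂], ∃ g⋆ > 0, every in-interval (]0,γ]) solution of (0.20) that sits at γ at a step k ≤ n has g_n ≥ g⋆`.
The END binder of the T⁴ headline, EXACTLY, in the currency of what the top runs of the flow do. [cite: Balaban1987RG1, Thm 2 p.259] -/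
theorem endpointExistence_iff_topRuns {C : B12.Construction} {β : HBeta} (hgen : ForwardGenerated C β) (hhalt : HaltsOutside C β)
    (hcur : CurriesHBeta C β) {γ₀ β' : ℝ} (hγ₀ : 0 < γ₀) (hβ' : 0 ≤ β') (hcont : BetaContH γ₀ β) (hhi : BetaUpperH β' γ₀ β)
    (hord : ∀ γ : ℝ, 0 < γ → γ ≤ γ₀ → ∀ (n : ℕ) (gs gs' : ℕ → ℝ), RGEqH n β gs → RGEqH n β gs' →
      Step.InInterval γ n gs → Step.InInterval γ n gs' → gs 0 < gs' 0 → ∀ k, k ≤ n → gs k < gs' k) :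
    EndpointExistence C ↔
      ∃ γ₂ : ℝ, 0 < γ₂ ∧ ∀ γ : ℝ, 0 < γ → γ ≤ γ₂ → ∃ gstar : ℝ, 0 < gstar ∧
        ∀ (n : ℕ) (gs : ℕ → ℝ), RGEqH n β gs → Step.InInterval γ n gs → ∀ k, k ≤ n → gs k = γ → gstar ≤ gs n := by
  constructor
  · intro hE
    obtain ⟨γ₂, hγ₂, H⟩ := hE 0
    refine ⟨min γ₂ γ₀, lt_min hγ₂ hγ₀, fun γ hγ hγle => ?_⟩
    obtain ⟨gstar, hgstar, Hg⟩ := H γ hγ (hγle.trans (min_le_left _ _))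
    -- shrink the target below `γ`; reachability of it via the construction's own runs, which solve (0.20) (`rgEqH_of_inInterval`)
    refine ⟨min gstar γ, lt_min hgstar hγ, fun n gs hrg hI k hk hgk => ?_⟩
    have hreach : ∀ K : ℕ, ∃ gs : ℕ → ℝ, gs K = min gstar γ ∧ RGEqH K β gs ∧ Step.InInterval γ K gs := by
      intro K
      obtain ⟨g0, hIK, hK⟩ := Hg (min gstar γ) (lt_min hgstar hγ) (min_le_left _ _) K
      exact ⟨(C ⟨K, 0, g0⟩).flow.g, hK, rgEqH_of_inInterval hgen hhalt hcur ⟨K, 0, g0⟩ hIK, hIK⟩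
    exact le_end_of_topRun (hord γ hγ (hγle.trans (min_le_right _ _))) hreach hrg hI hk hgk
  · rintro ⟨γ₂, hγ₂, H⟩ m
    refine ⟨min γ₂ γ₀, lt_min hγ₂ hγ₀, fun γ hγ hγle => ?_⟩
    have hγ₀le : γ ≤ γ₀ := hγle.trans (min_le_right _ _)
    obtain ⟨gstar, hgstar, htop⟩ := H γ hγ (hγle.trans (min_le_left _ _))
    refine ⟨min gstar γ, lt_min hgstar hγ, fun g hg hgle K => ?_⟩
    have hcont' : BetaContH γ β := fun k => (hcont k).mono (box_mono hγ₀le k)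
    have hhi' : BetaUpperH β' γ β := fun k v hv => hhi k v (box_mono hγ₀le k hv)
    have htop' : ∀ (n : ℕ) (gs : ℕ → ℝ), RGEqH n β gs → Step.InInterval γ n gs →
        ∀ k, k ≤ n → gs k = γ → min gstar γ ≤ gs n :=
      fun n gs hrg hI k hk hgk => (min_le_left _ _).trans (htop n gs hrg hI k hk hgk)
    obtain ⟨gs, hgsK, hrg, hI⟩ := (reachable_iff_topRuns hγ hβ' hcont' hhi' (hord γ hγ hγ₀le) (lt_min hgstar hγ)
      (min_le_right _ _)).2 htop' K g hg hgle
    have heq : ∀ k, k ≤ K → (C ⟨K, m, gs 0⟩).flow.g k = gs k :=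
      flow_eq_of_rgEqH (C ⟨K, m, gs 0⟩).flow β K (fun k hk => hgen.2 ⟨K, m, gs 0⟩ k hk)
        (hgen.1 ⟨K, m, gs 0⟩) hrg (fun k hk => (hI k hk).1)
    refine ⟨gs 0, fun k hk => ?_, ?_⟩
    · rw [heq k hk]; exact hI k hk
    · rw [heq K le_rfl]; exact hgsK

/-- The same criterion for the CANONICAL construction `modelOf β` (the three modelling clauses hold by `FlowStepRuns` §6), i.e. the END binder as
a property of `β` ALONE on order-preserving data. [cite: Balaban1987RG1, Thm 2 p.259] -/
theorem endpointExistence_modelOf_iff_topRuns {β : HBeta} {γ₀ β' : ℝ} (hγ₀ : 0 < γ₀) (hβ' : 0 ≤ β') (hcont : BetaContH γ₀ β)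
    (hhi : BetaUpperH β' γ₀ β)
    (hord : ∀ γ : ℝ, 0 < γ → γ ≤ γ₀ → ∀ (n : ℕ) (gs gs' : ℕ → ℝ), RGEqH n β gs → RGEqH n β gs' →
      Step.InInterval γ n gs → Step.InInterval γ n gs' → gs 0 < gs' 0 → ∀ k, k ≤ n → gs k < gs' k) :
    EndpointExistence (modelOf β) ↔
      ∃ γ₂ : ℝ, 0 < γ₂ ∧ ∀ γ : ℝ, 0 < γ → γ ≤ γ₂ → ∃ gstar : ℝ, 0 < gstar ∧
        ∀ (n : ℕ) (gs : ℕ → ℝ), RGEqH n β gs → Step.InInterval γ n gs → ∀ k, k ≤ n → gs k = γ → gstar ≤ gs n :=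
  endpointExistence_iff_topRuns (modelOf_forwardGenerated β) (modelOf_haltsOutside β) (modelOf_curries β) hγ₀ hβ' hcont hhi hord

/-- MARKOV PACKAGE: for `β = ofMarkov βM` with every `β_{k+1}` Lipschitz on `]0,γ₀]` with constant `≤ 2∕γ₀³` (hence `≤ 2∕γ³` on every smaller
box), jointly continuous and `≤ β′` on the boxes, the END binder of `modelOf β` is EXACTLY the top-run condition. [cite: Balaban1987RG1, (0.20) p.256 and §1 p.263] -/
theorem endpointExistence_ofMarkov_iff_topRuns {βM : ℕ → ℝ → ℝ} {γ₀ β' : ℝ} (hγ₀ : 0 < γ₀) (hβ' : 0 ≤ β')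
    (hcont : BetaContH γ₀ (ofMarkov βM)) (hhi : BetaUpperH β' γ₀ (ofMarkov βM))
    (hlip : ∀ (k : ℕ) (x y : ℝ), 0 < x → x ≤ γ₀ → 0 < y → y ≤ γ₀ →
      |βM (k + 1) x - βM (k + 1) y| ≤ 2 / γ₀ ^ 3 * |x - y|) :
    EndpointExistence (modelOf (ofMarkov βM)) ↔
      ∃ γ₂ : ℝ, 0 < γ₂ ∧ ∀ γ : ℝ, 0 < γ → γ ≤ γ₂ → ∃ gstar : ℝ, 0 < gstar ∧
        ∀ (n : ℕ) (gs : ℕ → ℝ), RGEqH n (ofMarkov βM) gs → Step.InInterval γ n gs →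
          ∀ k, k ≤ n → gs k = γ → gstar ≤ gs n := by
  refine endpointExistence_modelOf_iff_topRuns hγ₀ hβ' hcont hhi fun γ hγ hγle => ?_
  -- Lipschitz constant `2∕γ₀³ ≤ 2∕γ³` on the smaller box
  have hlipγ : ∀ (k : ℕ) (x y : ℝ), 0 < x → x ≤ γ → 0 < y → y ≤ γ →
      |βM (k + 1) x - βM (k + 1) y| ≤ 2 / γ ^ 3 * |x - y| := by
    intro k x y hx hxγ hy hyγ
    have h := hlip k x y hx (hxγ.trans hγle) hy (hyγ.trans hγle)
    have hc : 2 / γ₀ ^ 3 ≤ 2 / γ ^ 3 := div_le_div_of_nonneg_left (by norm_num) (by positivity) (pow_le_pow_left₀ hγ.le hγle 3)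
    exact h.trans (mul_le_mul_of_nonneg_right hc (abs_nonneg _))
  intro n gs gs' hrg hrg' hI hI' h0
  exact strictOrder_ofMarkov (anti_of_lipschitz hγ hlipγ) hrg hrg' hI hI' h0

end

end Summit.QuantumFields.BalabanUV.Gaps.EndTopRunCriterion
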